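import Mathlib.Topology.MetricSpace.Lipschitz
import Mathlib.Topology.MetricSpace.HausdorffDistance
import Mathlib.Topology.Order.IntermediateValue
import Mathlib.Topology.Order.Monotone
import HarnessLib

/-!
# Hochman 2025, §4: flat paths around finitely many disjoint obstacles (Prop. 4.9 (4))

The path-existence step of §4 of M. Hochman, *Irreducibility and periodicity in `ℤ²` symbolic
systems* (Discrete Analysis 2025:17), isolated as a lemma of plane geometry. Prop. 4.9 (4): "If
`p ∈ ℝ² ∖ ⋃H`, then there exists a polygonal graph `γ` passing through `p`, disjoint from `H`, and
with all line segments in the path having slope at most `α₁` in absolute value"; proof (p. 16):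
"we can form a polygonal path through `p` by traveling horizontally in either direction; if we hit
a double jigsaw in `H`, we follow its boundary until it is possible to continue horizontally ...
we can perturb the path by slightly raising or lowering each line segment that follows a boundary
of an element of `H` in order to avoid the boundary entirely."

We prove this greedy construction for an abstract finite family of pairwise disjoint *blobs*: a
blob is the region between two `K`-Lipschitz graphs `bot ≤ top` over a compact interval `[l, r]`,
pinched at both ends (`bot l = top l`, `bot r = top r`) — the shape of (a connected component of)
a double jigsaw. From a point `q` outside all blobs we travel horizontally to the right until the
first contact with a blob `B`; if the contact is on the roof of `B` (or at its left pinch point) we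
follow `top + ε` to the right end of `B`, if on the floor we follow `bot - ε`, with `ε` so small
that this stays clear of all other blobs (they are at positive distance from the compact `B`) and
with a short ramp of slope `α` before a pinch contact; from the right end of `B` we recurse on the
remaining blobs (`B` lies entirely to the left from there on). The resulting function is
`α`-Lipschitz for any `α ≥ K` with `α > 0`, passes through `q`, and its graph to the right of `q`
misses every blob (`SafePaths.exists_path_Ici`); by reflection the same holds to the left, and
gluing the two gives a bi-infinite `α`-Lipschitz graph through `q` missing all blobs
(`SafePaths.exists_path`).

The last section is a combinatorial tool for presenting a region with disconnected support as a
family of blobs: finitely many compact intervals `[a i, b i]` are merged into the classes of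
"joined by a chain of pairwise intersecting intervals"; the hull `[hullLeft i, hullRight i]` of a
class is covered by its intervals (`SafePaths.exists_mem_of_mem_hull`), hulls of non-linked
indices are disjoint (`SafePaths.linked_or_disjoint`), and no interval straddles an end of a
hull (`SafePaths.lt_hullLeft_of_lt`, `SafePaths.hullRight_lt_of_lt`).

## Main statements

* `SafePaths.Blob`, `SafePaths.Blob.toSet` — blobs; `SafePaths.first_contact`,
  `SafePaths.contact_side`, `SafePaths.over_segment`, `SafePaths.under_segment` — the steps of
  the greedy construction; `SafePaths.exists_path_Ici`, `SafePaths.exists_path` — the flat paths.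
* `SafePaths.Linked`, `SafePaths.cls`, `SafePaths.hullLeft`, `SafePaths.hullRight` and the three
  properties above.

## References

* [Hochman2025] M. Hochman, *Irreducibility and periodicity in `ℤ²` symbolic systems*, Discrete
  Analysis 2025:17, Prop. 4.9 (4) and its proof (pp. 14–16). Read via `lit read arxiv:2401.02273`.
-/

noncomputable section

open Set
open scoped Classical NNReal

namespace Literature.Dynamics.SymbolicDynamics

namespace Hochman2025

namespace SafePaths

/-! ### Blobs -/

/-- A **blob** with `K`-Lipschitz boundary: the plane region between the graphs of `bot ≤ top`
over the compact interval `[l, r]`, pinched at both ends. (The connected components of Hochman's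
double jigsaws, Def. 4.5, have this shape.) [cite: Hochman2025, Def 4.5] -/
structure Blob (K : ℝ≥0) where
  /-- left end of the supporting interval -/
  l : ℝ
  /-- right end of the supporting interval -/
  r : ℝ
  hlr : l ≤ r
  /-- upper boundary -/
  top : ℝ → ℝ
  /-- lower boundary -/
  bot : ℝ → ℝ
  top_lip : LipschitzWith K top
  bot_lip : LipschitzWith K bot
  bot_le_top : ∀ x, l ≤ x → x ≤ r → bot x ≤ top x
  pinch_l : bot l = top l
  pinch_r : bot r = top r

variable {K : ℝ≥0}

namespace Blob

/-- The blob as a plane set. [cite: Hochman2025, Def 4.5] -/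
def toSet (B : Blob K) : Set (ℝ × ℝ) :=
  {q | B.l ≤ q.1 ∧ q.1 ≤ B.r ∧ B.bot q.1 ≤ q.2 ∧ q.2 ≤ B.top q.1}

/-- Membership in a blob. [folklore] -/
theorem mem_toSet {B : Blob K} {q : ℝ × ℝ} :
    q ∈ B.toSet ↔ B.l ≤ q.1 ∧ q.1 ≤ B.r ∧ B.bot q.1 ≤ q.2 ∧ q.2 ≤ B.top q.1 := Iff.rfl

/-- Blobs are closed. [folklore] -/
theorem isClosed_toSet (B : Blob K) : IsClosed B.toSet := by
  have hc1 : Continuous fun q : ℝ × ℝ => q.1 := continuous_fst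
  have hc2 : Continuous fun q : ℝ × ℝ => q.2 := continuous_snd
  have hct : Continuous fun q : ℝ × ℝ => B.top q.1 := B.top_lip.continuous.comp continuous_fst
  have hcb : Continuous fun q : ℝ × ℝ => B.bot q.1 := B.bot_lip.continuous.comp continuous_fst
  simp only [toSet]
  refine ((isClosed_le continuous_const hc1).inter ((isClosed_le hc1 continuous_const).inter
    ((isClosed_le hcb hc2).inter (isClosed_le hc2 hct))))

/-- Lipschitz functions are bounded on compact intervals (values stay within `K * (r - l)` of the
value at `l`). [folklore] -/
theorem abs_sub_le_of_lipschitz {f : ℝ → ℝ} (hf : LipschitzWith K f) {l x : ℝ} :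
    |f x - f l| ≤ K * |x - l| := by
  have := lipschitzWith_iff_dist_le_mul.mp hf x l
  rwa [Real.dist_eq, Real.dist_eq] at this

/-- Blobs are bounded, hence compact. [folklore] -/
theorem isCompact_toSet (B : Blob K) : IsCompact B.toSet := by
  -- inside the box `[l, r] × [bot l - K(r-l), top l + K(r-l)]`
  have hsub : B.toSet ⊆ Icc B.l B.r ×ˢ Icc (B.bot B.l - K * (B.r - B.l)) (B.top B.l + K * (B.r - B.l)) := by
    rintro ⟨x, y⟩ ⟨h1, h2, h3, h4⟩
    simp only at h1 h2 h3 h4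
    refine ⟨⟨h1, h2⟩, ?_, ?_⟩
    · have hb := abs_sub_le_of_lipschitz B.bot_lip (l := B.l) (x := x)
      rw [abs_of_nonneg (by linarith : 0 ≤ x - B.l)] at hb
      rw [abs_le] at hb
      have hK : (0:ℝ) ≤ K := K.2
      nlinarith [mul_le_mul_of_nonneg_left h2 hK]
    · have ht := abs_sub_le_of_lipschitz B.top_lip (l := B.l) (x := x)
      rw [abs_of_nonneg (by linarith : 0 ≤ x - B.l)] at ht
      rw [abs_le] at ht
      have hK : (0:ℝ) ≤ K := K.2
      nlinarith [mul_le_mul_of_nonneg_left h2 hK]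
  exact (isCompact_Icc.prod isCompact_Icc).of_isClosed_subset B.isClosed_toSet hsub

/-- The roof point above an abscissa of the support belongs to the blob. [folklore] -/
theorem top_mem {B : Blob K} {x : ℝ} (h1 : B.l ≤ x) (h2 : x ≤ B.r) : (x, B.top x) ∈ B.toSet :=
  ⟨h1, h2, B.bot_le_top x h1 h2, le_rfl⟩

/-- The floor point belongs to the blob. [folklore] -/
theorem bot_mem {B : Blob K} {x : ℝ} (h1 : B.l ≤ x) (h2 : x ≤ B.r) : (x, B.bot x) ∈ B.toSet :=
  ⟨h1, h2, le_rfl, B.bot_le_top x h1 h2⟩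

/-- Blobs with the same data are equal. [folklore] -/
theorem ext' {B B' : Blob K} (hl : B.l = B'.l) (hr : B.r = B'.r) (ht : B.top = B'.top)
    (hb : B.bot = B'.bot) : B = B' := by
  cases B; cases B'
  cases hl; cases hr; cases ht; cases hb
  rfl

/-- The reflection `x ↦ -x` of a blob. [folklore] -/
def reflect (B : Blob K) : Blob K where
  l := -B.r
  r := -B.l
  hlr := by linarith [B.hlr]
  top := fun x => B.top (-x)
  bot := fun x => B.bot (-x)
  top_lip := lipschitzWith_iff_dist_le_mul.mpr fun x y => by
    have := lipschitzWith_iff_dist_le_mul.mp B.top_lip (-x) (-y)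
    rwa [Real.dist_eq, Real.dist_eq, show -x - -y = -(x - y) by ring, abs_neg,
      ← Real.dist_eq x y] at this
  bot_lip := lipschitzWith_iff_dist_le_mul.mpr fun x y => by
    have := lipschitzWith_iff_dist_le_mul.mp B.bot_lip (-x) (-y)
    rwa [Real.dist_eq, Real.dist_eq, show -x - -y = -(x - y) by ring, abs_neg,
      ← Real.dist_eq x y] at this
  bot_le_top := fun x h1 h2 => B.bot_le_top (-x) (by linarith) (by linarith)
  pinch_l := by simpa using B.pinch_r
  pinch_r := by simpa using B.pinch_l

/-- Membership in the reflected blob. [folklore] -/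
theorem mem_reflect {B : Blob K} {q : ℝ × ℝ} : q ∈ B.reflect.toSet ↔ (-q.1, q.2) ∈ B.toSet := by
  simp only [mem_toSet, reflect]
  constructor
  · rintro ⟨h1, h2, h3, h4⟩; exact ⟨by linarith, by linarith, h3, h4⟩
  · rintro ⟨h1, h2, h3, h4⟩; exact ⟨by linarith, by linarith, h3, h4⟩

end Blob

/-! ### Distances between disjoint blobs, and Lipschitz bookkeeping -/

/-- Two disjoint blobs are at positive distance (both are compact). [folklore] -/
theorem exists_pos_le_dist {B B' : Blob K} (h : Disjoint B.toSet B'.toSet) :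
    ∃ δ : ℝ, 0 < δ ∧ ∀ q ∈ B.toSet, ∀ q' ∈ B'.toSet, δ ≤ dist q q' := by
  rcases (B.toSet ×ˢ B'.toSet).eq_empty_or_nonempty with he | hne
  · refine ⟨1, one_pos, fun q hq q' hq' => ?_⟩
    have : (q, q') ∈ B.toSet ×ˢ B'.toSet := ⟨hq, hq'⟩
    rw [he] at this
    exact absurd this (notMem_empty _)
  · have hc : Continuous fun pq : (ℝ × ℝ) × (ℝ × ℝ) => dist pq.1 pq.2 := continuous_dist
    obtain ⟨⟨q₀, q₀'⟩, hmem, hmin⟩ :=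
      (B.isCompact_toSet.prod B'.isCompact_toSet).exists_isMinOn hne hc.continuousOn
    have hpos : 0 < dist q₀ q₀' := by
      rw [dist_pos]
      intro heq
      exact h.le_bot ⟨hmem.1, heq ▸ hmem.2⟩
    refine ⟨dist q₀ q₀', hpos, fun q hq q' hq' => ?_⟩
    exact hmin (show (q, q') ∈ B.toSet ×ˢ B'.toSet from ⟨hq, hq'⟩)

/-- A uniform positive lower bound for the distances from one blob of a finite pairwise-disjoint
family to all the others. [folklore] -/
theorem exists_pos_le_dist_others {𝔅 : Finset (Blob K)}
    (hdisj : ∀ B ∈ 𝔅, ∀ B' ∈ 𝔅, B ≠ B' → Disjoint B.toSet B'.toSet) {B : Blob K} (hB : B ∈ 𝔅) :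
    ∃ δ : ℝ, 0 < δ ∧ ∀ B' ∈ 𝔅, B' ≠ B → ∀ q ∈ B.toSet, ∀ q' ∈ B'.toSet, δ ≤ dist q q' := by
  -- take the minimum over the finitely many other blobs
  have key : ∀ (T : Finset (Blob K)), T ⊆ 𝔅 →
      ∃ δ : ℝ, 0 < δ ∧ ∀ B' ∈ T, B' ≠ B → ∀ q ∈ B.toSet, ∀ q' ∈ B'.toSet, δ ≤ dist q q' := by
    intro T
    induction T using Finset.induction_on with
    | empty => intro _; exact ⟨1, one_pos, fun B' hB' => by simp at hB'⟩
    | @insert B₀ T hB₀ ih =>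
      intro hT
      obtain ⟨δ, hδ, hδT⟩ := ih ((Finset.subset_insert _ _).trans hT)
      by_cases hne : B₀ = B
      · refine ⟨δ, hδ, fun B' hB' hB'ne => ?_⟩
        rcases Finset.mem_insert.mp hB' with rfl | hB'T
        · exact absurd hne hB'ne
        · exact hδT B' hB'T hB'ne
      · obtain ⟨δ₀, hδ₀, hδ₀B⟩ := exists_pos_le_dist
          (hdisj B hB B₀ (hT (Finset.mem_insert_self _ _)) (Ne.symm hne))
        refine ⟨min δ δ₀, lt_min hδ hδ₀, fun B' hB' hB'ne q hq q' hq' => ?_⟩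
        rcases Finset.mem_insert.mp hB' with rfl | hB'T
        · exact (min_le_right _ _).trans (hδ₀B q hq q' hq')
        · exact (min_le_left _ _).trans (hδT B' hB'T hB'ne q hq q' hq')
  exact key 𝔅 (Finset.Subset.refl _)

/-- Real form of a Lipschitz bound. [folklore] -/
theorem lip_iff {f : ℝ → ℝ} {α : ℝ≥0} :
    LipschitzWith α f ↔ ∀ x y, |f x - f y| ≤ α * |x - y| := by
  rw [lipschitzWith_iff_dist_le_mul]
  simp only [Real.dist_eq]

/-- Gluing two Lipschitz functions that agree at the junction. [folklore] -/
theorem lip_glue {f g : ℝ → ℝ} {α : ℝ≥0} {c : ℝ} (hf : ∀ x y, |f x - f y| ≤ α * |x - y|)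
    (hg : ∀ x y, |g x - g y| ≤ α * |x - y|) (hc : f c = g c) :
    ∀ x y, |(fun t => if t ≤ c then f t else g t) x - (fun t => if t ≤ c then f t else g t) y|
      ≤ α * |x - y| := by
  have hα : (0:ℝ) ≤ α := α.2
  -- reduce to the ordered case
  suffices key : ∀ x y, x ≤ y →
      |(if x ≤ c then f x else g x) - (if y ≤ c then f y else g y)| ≤ α * |x - y| by
    intro x y
    rcases le_total x y with h | h
    · exact key x y h
    · rw [abs_sub_comm, abs_sub_comm x y]; exact key y x h
  intro x y hxy
  by_cases hx : x ≤ c <;> by_cases hy : y ≤ c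
  · simp only [hx, hy, if_true]; exact hf x y
  · simp only [hx, hy, if_true, if_false]
    push Not at hy
    have h1 := hf x c
    have h2 := hg c y
    rw [hc] at h1
    have : |f x - g y| ≤ |f x - g c| + |g c - g y| := abs_sub_le _ _ _
    rw [abs_of_nonpos (by linarith : x - c ≤ 0)] at h1
    rw [abs_of_nonpos (by linarith : c - y ≤ 0)] at h2
    rw [abs_of_nonpos (by linarith : x - y ≤ 0)]
    nlinarith
  · exact absurd (hxy.trans hy) hx
  · simp only [hx, hy, if_false]; exact hg x y

/-- `max` with a constant keeps a Lipschitz bound. [folklore] -/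
theorem lip_max_const {f : ℝ → ℝ} {α : ℝ≥0} (hf : ∀ x y, |f x - f y| ≤ α * |x - y|) (c : ℝ) :
    ∀ x y, |max c (f x) - max c (f y)| ≤ α * |x - y| :=
  fun x y => by
    rw [max_comm c, max_comm c]
    exact (abs_max_sub_max_le_abs _ _ _).trans (hf x y)

/-- `min` with a constant keeps a Lipschitz bound. [folklore] -/
theorem lip_min_const {f : ℝ → ℝ} {α : ℝ≥0} (hf : ∀ x y, |f x - f y| ≤ α * |x - y|) (c : ℝ) :
    ∀ x y, |min c (f x) - min c (f y)| ≤ α * |x - y| :=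
  fun x y => (abs_min_sub_min_le_max _ _ _ _).trans (by
    rw [sub_self, abs_zero, max_eq_right (abs_nonneg _)]; exact hf x y)

/-- Adding a constant keeps a Lipschitz bound. [folklore] -/
theorem lip_add_const {f : ℝ → ℝ} {α : ℝ≥0} (hf : ∀ x y, |f x - f y| ≤ α * |x - y|) (c : ℝ) :
    ∀ x y, |(f x + c) - (f y + c)| ≤ α * |x - y| :=
  fun x y => by rw [show f x + c - (f y + c) = f x - f y by ring]; exact hf x y

/-- A Lipschitz bound with a smaller constant gives one with a larger constant. [folklore] -/
theorem lip_mono {f : ℝ → ℝ} {α α' : ℝ≥0} (hf : ∀ x y, |f x - f y| ≤ α * |x - y|) (h : α ≤ α') :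
    ∀ x y, |f x - f y| ≤ α' * |x - y| :=
  fun x y => (hf x y).trans (mul_le_mul_of_nonneg_right (by exact_mod_cast h) (abs_nonneg _))

/-- Extending a function to the left of `l` by a line of slope `α` keeps the bound `α`
(when the function itself has a bound `≤ α`). [folklore] -/
theorem lip_extend_left {f : ℝ → ℝ} {α : ℝ≥0} (hf : ∀ x y, |f x - f y| ≤ α * |x - y|) (l : ℝ)
    (s : ℝ) (hs : |s| ≤ α) :
    ∀ x y, |(fun t => if t ≤ l then f l + s * (t - l) else f t) x
      - (fun t => if t ≤ l then f l + s * (t - l) else f t) y| ≤ α * |x - y| := by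
  have hline : ∀ x y, |(f l + s * (x - l)) - (f l + s * (y - l))| ≤ α * |x - y| := by
    intro x y
    rw [show f l + s * (x - l) - (f l + s * (y - l)) = s * (x - y) by ring, abs_mul]
    exact mul_le_mul_of_nonneg_right hs (abs_nonneg _)
  have := lip_glue (f := fun t => f l + s * (t - l)) (g := f) (c := l) hline hf (by simp)
  simpa using this


/-! ### First contact of a horizontal ray with the obstacles -/

/-- **First contact.** From a point `q` outside all blobs, the horizontal ray to the right either
misses every blob, or it meets some blob for the first time at an abscissa `xc > q.1`, before
which it is clear. [cite: Hochman2025, Prop 4.9 (4)] -/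
theorem first_contact (𝔅 : Finset (Blob K)) (q : ℝ × ℝ) (hq : ∀ B ∈ 𝔅, q ∉ B.toSet) :
    (∀ x, q.1 ≤ x → ∀ B ∈ 𝔅, (x, q.2) ∉ B.toSet) ∨
    ∃ xc, q.1 < xc ∧ (∃ B ∈ 𝔅, (xc, q.2) ∈ B.toSet) ∧
      ∀ x, q.1 ≤ x → x < xc → ∀ B ∈ 𝔅, (x, q.2) ∉ B.toSet := by
  set C : Set ℝ := {x | q.1 ≤ x ∧ ∃ B ∈ 𝔅, (x, q.2) ∈ B.toSet} with hC
  rcases C.eq_empty_or_nonempty with hCe | hCne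
  · left
    intro x hx B hB hmem
    have : x ∈ C := ⟨hx, B, hB, hmem⟩
    rw [hCe] at this
    exact this
  · right
    have hclosed : IsClosed C := by
      have h1 : IsClosed {x : ℝ | q.1 ≤ x} := isClosed_le continuous_const continuous_id
      have h2 : IsClosed (⋃ B ∈ (𝔅 : Set (Blob K)), {x : ℝ | (x, q.2) ∈ B.toSet}) := by
        refine 𝔅.finite_toSet.isClosed_biUnion fun B _ => ?_
        exact B.isClosed_toSet.preimage (by fun_prop)
      have : C = {x : ℝ | q.1 ≤ x} ∩ ⋃ B ∈ (𝔅 : Set (Blob K)), {x : ℝ | (x, q.2) ∈ B.toSet} := by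
        ext x
        simp only [hC, mem_setOf_eq, mem_inter_iff, mem_iUnion, Finset.mem_coe, exists_prop]
      rw [this]
      exact h1.inter h2
    have hbdd : BddBelow C := ⟨q.1, fun x hx => hx.1⟩
    set xc := sInf C with hxc
    have hxcC : xc ∈ C := hclosed.csInf_mem hCne hbdd
    obtain ⟨hqxc, B, hB, hmem⟩ := hxcC
    refine ⟨xc, ?_, ⟨B, hB, hmem⟩, ?_⟩
    · rcases hqxc.lt_or_eq with h | h
      · exact h
      · have heq : q = (xc, q.2) := Prod.ext h rfl
        exact absurd (by rw [heq]; exact hmem) (hq B hB)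
    · intro x hx hlt B' hB' hmem'
      have : xc ≤ x := csInf_le hbdd ⟨hx, B', hB', hmem'⟩
      linarith

/-- **Side of the contact.** At the first contact with the blob `B`, the ray has been travelling
either above the roof of `B` (since entering its abscissae), or below its floor — unless the
contact is the left pinch point of `B`, which we count as "above". (The complement of the fibre
is the disjoint union of two open conditions along a connected interval.)
[cite: Hochman2025, Prop 4.9 (4)] -/
theorem contact_side (B : Blob K) (q : ℝ × ℝ) {xc : ℝ} (hqxc : q.1 < xc)
    (hmem : (xc, q.2) ∈ B.toSet)
    (hfirst : ∀ x, q.1 ≤ x → x < xc → (x, q.2) ∉ B.toSet) :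
    (∀ x, max q.1 B.l ≤ x → x < xc → B.top x < q.2) ∨
    (B.l < xc ∧ ∀ x, max q.1 B.l ≤ x → x < xc → q.2 < B.bot x) := by
  obtain ⟨hl, hr, -, -⟩ := hmem
  rcases hl.lt_or_eq with hlxc | hlxc
  swap
  · -- pinch contact: the hypothesis range is empty
    left
    intro x hx hlt
    have : B.l ≤ x := le_trans (le_max_right _ _) hx
    linarith
  set m := max q.1 B.l with hm
  have hmxc : m < xc := max_lt hqxc hlxc
  have hml : B.l ≤ m := le_max_right _ _
  -- on `(m, xc)` the ray is outside `B`, hence above the roof or below the floor, consistently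
  set u : Set ℝ := {x | B.top x < q.2} ∩ Ioo B.l xc with hu
  set v : Set ℝ := {x | q.2 < B.bot x} ∩ Ioo B.l xc with hv
  have huo : IsOpen u := (isOpen_lt B.top_lip.continuous continuous_const).inter isOpen_Ioo
  have hvo : IsOpen v := (isOpen_lt continuous_const B.bot_lip.continuous).inter isOpen_Ioo
  have huv : Disjoint u v := by
    rw [Set.disjoint_left]
    rintro x ⟨hxu, hxl, hxr⟩ ⟨hxv, -, -⟩
    have := B.bot_le_top x hxl.le (hxr.le.trans hr)
    exact absurd (hxu.trans hxv) (not_lt.mpr this)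
  have hJ : Ioo m xc ⊆ u ∪ v := by
    intro x ⟨hx1, hx2⟩
    have hxl : B.l < x := lt_of_le_of_lt hml hx1
    have hxq : q.1 ≤ x := (le_max_left _ _).trans hx1.le
    have hout := hfirst x hxq hx2
    simp only [Blob.mem_toSet, not_and, not_le] at hout
    by_cases htop : B.top x < q.2
    · exact Or.inl ⟨htop, hxl, hx2⟩
    · push Not at htop
      have := hout hxl.le (hx2.le.trans hr)
      by_cases hbot : B.bot x ≤ q.2
      · exact absurd (this hbot) (not_lt.mpr htop)
      · push Not at hbot
        exact Or.inr ⟨hbot, hxl, hx2⟩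
  have hconn : IsPreconnected (Ioo m xc) := isPreconnected_Ioo
  -- extension to the left end `m` by continuity and the first-contact property
  have hmout : (m, q.2) ∉ B.toSet := hfirst m (le_max_left _ _) hmxc
  rcases hconn.subset_or_subset huo hvo huv hJ with hsub | hsub
  · left
    intro x hx hlt
    rcases hx.lt_or_eq with hlt' | heq
    · exact (hsub ⟨hlt', hlt⟩).1
    · -- `x = m`: `top m ≤ q.2` by continuity, and `≠` since `(m, top m) ∈ B` would be a contact
      subst heq
      have hle : B.top m ≤ q.2 := by
        by_contra hgt
        push Not at hgt
        have hev := (B.top_lip.continuous.continuousAt (x := m)).eventually (lt_mem_nhds hgt)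
        obtain ⟨δ, hδ, hδprop⟩ := Metric.eventually_nhds_iff.mp hev
        set x := m + min δ (xc - m) / 2 with hxdef
        have hmin : 0 < min δ (xc - m) := lt_min hδ (by linarith)
        have hx1 : m < x := by rw [hxdef]; linarith
        have hx2 : x < xc := by
          have : min δ (xc - m) ≤ xc - m := min_le_right _ _
          rw [hxdef]; linarith
        have hxd : dist x m < δ := by
          rw [Real.dist_eq, abs_of_pos (by linarith)]
          have : min δ (xc - m) ≤ δ := min_le_left _ _
          rw [hxdef]; linarith
        have h1 := hδprop hxd
        have h2 : B.top x < q.2 := (hsub ⟨hx1, hx2⟩).1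
        linarith
      rcases hle.lt_or_eq with hlt' | heq'
      · exact hlt'
      · exact absurd (heq' ▸ Blob.top_mem hml (hmxc.le.trans hr)) hmout
  · right
    refine ⟨hlxc, ?_⟩
    intro x hx hlt
    rcases hx.lt_or_eq with hlt' | heq
    · exact (hsub ⟨hlt', hlt⟩).1
    · subst heq
      have hle : q.2 ≤ B.bot m := by
        by_contra hgt
        push Not at hgt
        have hev := (B.bot_lip.continuous.continuousAt (x := m)).eventually (gt_mem_nhds hgt)
        obtain ⟨δ, hδ, hδprop⟩ := Metric.eventually_nhds_iff.mp hev
        set x := m + min δ (xc - m) / 2 with hxdef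
        have hmin : 0 < min δ (xc - m) := lt_min hδ (by linarith)
        have hx1 : m < x := by rw [hxdef]; linarith
        have hx2 : x < xc := by
          have : min δ (xc - m) ≤ xc - m := min_le_right _ _
          rw [hxdef]; linarith
        have hxd : dist x m < δ := by
          rw [Real.dist_eq, abs_of_pos (by linarith)]
          have : min δ (xc - m) ≤ δ := min_le_left _ _
          rw [hxdef]; linarith
        have h1 := hδprop hxd
        have h2 : q.2 < B.bot x := (hsub ⟨hx1, hx2⟩).1
        linarith
      rcases hle.lt_or_eq with hlt' | heq'
      · exact hlt'
      · exact absurd (heq'.symm ▸ Blob.bot_mem hml (hmxc.le.trans hr)) hmout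

/-! ### Passing over (or under) the contacted blob -/

/-- **The segment over a contacted blob, and its continuation.** Data: the first contact of the
ray from `q` with `B` at `xc`, from above; a clearance `ε` smaller than half the distance `δ₀`
from `B` to the other blobs (and than `α δ₀ / 2`, and small enough for the path to start at `q`);
and an `α`-Lipschitz continuation `f'` from the point `(B.r, B.top B.r + ε)` whose graph misses
the other blobs to the right of `B.r`. Conclusion: an `α`-Lipschitz function through `q` whose
graph misses all blobs to the right of `q`: it runs at height `q.2` up to the contact, rises (with
a ramp of slope `α` before a pinch contact) to `top + ε`, follows `top + ε` to the right end of
`B`, and continues with `f'`. [cite: Hochman2025, Prop 4.9 (4)] -/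
theorem over_segment {α : ℝ≥0} (hKα : K ≤ α) (hα : 0 < (α : ℝ)) {𝔅 : Finset (Blob K)}
    {B : Blob K} (q : ℝ × ℝ) {xc : ℝ} (hqxc : q.1 < xc)
    (hmem : (xc, q.2) ∈ B.toSet)
    (hfirst : ∀ x, q.1 ≤ x → x < xc → ∀ B' ∈ 𝔅, (x, q.2) ∉ B'.toSet)
    (habove : ∀ x, max q.1 B.l ≤ x → x < xc → B.top x < q.2)
    {δ₀ : ℝ}
    (hsep : ∀ B' ∈ 𝔅, B' ≠ B → ∀ p ∈ B.toSet, ∀ p' ∈ B'.toSet, δ₀ ≤ dist p p')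
    {ε : ℝ} (hε : 0 < ε) (hε₁ : ε ≤ δ₀ / 2) (hε₂ : ε ≤ α * δ₀ / 2)
    (hε₃ : q.1 < B.l → ε ≤ α * (B.l - q.1)) (hε₄ : B.l ≤ q.1 → ε < q.2 - B.top q.1)
    (f' : ℝ → ℝ) (hf' : ∀ x y, |f' x - f' y| ≤ α * |x - y|) (hf'r : f' B.r = B.top B.r + ε)
    (hf'safe : ∀ x, B.r ≤ x → ∀ B' ∈ 𝔅, B' ≠ B → (x, f' x) ∉ B'.toSet) :
    ∃ F : ℝ → ℝ, (∀ x y, |F x - F y| ≤ α * |x - y|) ∧ F q.1 = q.2 ∧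
      ∀ x, q.1 ≤ x → ∀ B' ∈ 𝔅, (x, F x) ∉ B'.toSet := by
  obtain ⟨hlxc, hxcr, hbotq, hq2top⟩ := hmem
  -- the roof extended to the left by a line of slope `α`
  set T : ℝ → ℝ := fun t => if t ≤ B.l then B.top B.l + α * (t - B.l) else B.top t with hT
  have hTlip : ∀ x y, |T x - T y| ≤ α * |x - y| :=
    lip_extend_left (lip_mono (lip_iff.mp B.top_lip) hKα) B.l α (by rw [abs_of_pos hα])
  have hTge : ∀ t, B.l ≤ t → T t = B.top t := by
    intro t ht
    simp only [hT]
    split_ifs with h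
    · rw [le_antisymm h ht]; ring
    · rfl
  have hTle : ∀ t, t ≤ B.l → T t = B.top B.l + α * (t - B.l) := by
    intro t ht; simp only [hT, if_pos ht]
  -- `top l ≤ q.2` as soon as the ray starts left of `l`
  have htopl : q.1 ≤ B.l → B.top B.l ≤ q.2 := by
    intro hql
    rcases eq_or_lt_of_le hlxc with heq | hlt
    · have : B.top B.l = B.bot xc := by rw [← B.pinch_l, heq]
      rw [this]; exact hbotq
    · exact (habove B.l (max_le hql le_rfl) hlt).le
  -- the segment: `max q.2 (T + ε)` up to the contact, then `top + ε`
  set g : ℝ → ℝ := fun t => if t ≤ xc then max q.2 (T t + ε) else B.top t + ε with hg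
  have hg₁lip : ∀ x y, |max q.2 (T x + ε) - max q.2 (T y + ε)| ≤ α * |x - y| :=
    lip_max_const (lip_add_const hTlip ε) q.2
  have hg₂lip : ∀ x y, |(B.top x + ε) - (B.top y + ε)| ≤ α * |x - y| :=
    lip_add_const (lip_mono (lip_iff.mp B.top_lip) hKα) ε
  have hTxc : T xc = B.top xc := hTge xc hlxc
  have hgxc : max q.2 (T xc + ε) = B.top xc + ε := by
    rw [hTxc]; exact max_eq_right (by linarith)
  have hglip : ∀ x y, |g x - g y| ≤ α * |x - y| := lip_glue hg₁lip hg₂lip hgxc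
  -- the whole path: `g` up to `B.r`, then `f'`
  have hgr : g B.r = f' B.r := by
    simp only [hg]
    split_ifs with h
    · have : xc = B.r := le_antisymm hxcr h
      rw [← this, hgxc, this, hf'r]
    · rw [hf'r]
  set F : ℝ → ℝ := fun t => if t ≤ B.r then g t else f' t with hF
  have hFlip : ∀ x y, |F x - F y| ≤ α * |x - y| := lip_glue hglip hf' hgr
  -- distance bookkeeping for points hugging the roof
  have hhug : ∀ x, B.l ≤ x → x ≤ B.r → ∀ B' ∈ 𝔅, (x, B.top x + ε) ∉ B'.toSet := by
    intro x hxl hxr B' hB'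
    have hroof : (x, B.top x) ∈ B.toSet := Blob.top_mem hxl hxr
    by_cases hB'B : B' = B
    · rw [hB'B]
      rintro ⟨-, -, -, h4⟩
      simp only at h4; linarith
    · intro hmem'
      have := hsep B' hB' hB'B _ hroof _ hmem'
      have hd : dist (x, B.top x) (x, B.top x + ε) = ε := by
        rw [Prod.dist_eq, dist_self, Real.dist_eq,
          show B.top x - (B.top x + ε) = -ε by ring, abs_neg, abs_of_pos hε,
          max_eq_right hε.le]
      linarith
  refine ⟨F, hFlip, ?_, ?_⟩
  · -- `F q.1 = q.2`
    have hq1r : q.1 ≤ B.r := hqxc.le.trans hxcr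
    simp only [hF, if_pos hq1r, hg, if_pos hqxc.le]
    apply max_eq_left
    by_cases hql : q.1 < B.l
    · rw [hTle q.1 hql.le]
      have h1 := hε₃ hql
      have h2 := htopl hql.le
      nlinarith
    · push Not at hql
      rw [hTge q.1 hql]
      have := hε₄ hql
      linarith
  · -- safety to the right of `q.1`
    intro x hx B' hB'
    simp only [hF]
    split_ifs with hxr
    · -- on the segment
      simp only [hg]
      split_ifs with hxxc
      · -- before/at the contact: `max q.2 (T x + ε)`
        by_cases hflat : T x + ε ≤ q.2
        · rw [max_eq_left hflat]
          have hlt : x < xc := by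
            rcases hxxc.lt_or_eq with h | h
            · exact h
            · exfalso; rw [h, hTxc] at hflat; linarith
          exact hfirst x hx hlt B' hB'
        · push Not at hflat
          rw [max_eq_right hflat.le]
          by_cases hxl : x ≤ B.l
          · -- ramp: near the pinch point `(l, top l) ∈ B`
            have hTx := hTle x hxl
            have hflat' : q.2 < B.top B.l + α * (x - B.l) + ε := by rwa [hTx] at hflat
            have hpin : (B.l, B.top B.l) ∈ B.toSet := Blob.top_mem le_rfl B.hlr
            have h1 : B.top B.l ≤ q.2 := htopl (hx.trans hxl)
            have h2 : α * (B.l - x) < ε := by linarith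
            have hclose : dist (x, T x + ε) (B.l, B.top B.l) < δ₀ := by
              rw [Prod.dist_eq, Real.dist_eq, Real.dist_eq, hTx]
              refine max_lt ?_ ?_
              · rw [abs_of_nonpos (by linarith)]
                have : B.l - x < δ₀ := by
                  by_contra hge; push Not at hge
                  have : α * δ₀ ≤ α * (B.l - x) := mul_le_mul_of_nonneg_left hge hα.le
                  linarith
                linarith
              · rw [show B.top B.l + α * (x - B.l) + ε - B.top B.l = ε - α * (B.l - x) by ring]
                have h3 : 0 ≤ α * (B.l - x) := mul_nonneg hα.le (by linarith)
                rw [abs_lt]; constructor <;> linarith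
            by_cases hB'B : B' = B
            · rw [hB'B]
              rintro ⟨h1', -, -, h4⟩
              simp only at h1' h4
              have hxeq : x = B.l := le_antisymm hxl h1'
              rw [hxeq, hTle _ le_rfl] at h4
              simp only [sub_self, mul_zero, add_zero] at h4
              linarith
            · intro hmem'
              have := hsep B' hB' hB'B _ hpin _ hmem'
              rw [dist_comm] at hclose
              linarith
          · -- hugging the roof within the blob's abscissae
            push Not at hxl
            rw [hTge x hxl.le]
            exact hhug x hxl.le (hxxc.trans hxcr) B' hB'
      · -- past the contact, hugging the roof
        push Not at hxxc
        exact hhug x (hlxc.trans hxxc.le) hxr B' hB'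
    · -- the continuation
      push Not at hxr
      by_cases hB'B : B' = B
      · rw [hB'B]
        rintro ⟨-, h2, -, -⟩
        simp only at h2; linarith
      · exact hf'safe x hxr.le B' hB' hB'B


/-- **The segment under a contacted blob, and its continuation** (mirror image of
`over_segment`; the contact is interior to the abscissae of `B`, pinch contacts being passed
over). [cite: Hochman2025, Prop 4.9 (4)] -/
theorem under_segment {α : ℝ≥0} (hKα : K ≤ α) {𝔅 : Finset (Blob K)}
    {B : Blob K} (q : ℝ × ℝ) {xc : ℝ} (hqxc : q.1 < xc)
    (hmem : (xc, q.2) ∈ B.toSet)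
    (hfirst : ∀ x, q.1 ≤ x → x < xc → ∀ B' ∈ 𝔅, (x, q.2) ∉ B'.toSet)
    (hbelow : ∀ x, max q.1 B.l ≤ x → x < xc → q.2 < B.bot x)
    {δ₀ : ℝ}
    (hsep : ∀ B' ∈ 𝔅, B' ≠ B → ∀ p ∈ B.toSet, ∀ p' ∈ B'.toSet, δ₀ ≤ dist p p')
    {ε : ℝ} (hε : 0 < ε) (hε₁ : ε ≤ δ₀ / 2)
    (hε₃ : q.1 < B.l → ε < B.bot B.l - q.2) (hε₄ : B.l ≤ q.1 → ε < B.bot q.1 - q.2)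
    (f' : ℝ → ℝ) (hf' : ∀ x y, |f' x - f' y| ≤ α * |x - y|) (hf'r : f' B.r = B.bot B.r - ε)
    (hf'safe : ∀ x, B.r ≤ x → ∀ B' ∈ 𝔅, B' ≠ B → (x, f' x) ∉ B'.toSet) :
    ∃ F : ℝ → ℝ, (∀ x y, |F x - F y| ≤ α * |x - y|) ∧ F q.1 = q.2 ∧
      ∀ x, q.1 ≤ x → ∀ B' ∈ 𝔅, (x, F x) ∉ B'.toSet := by
  obtain ⟨hlxc, hxcr, hbotq, hq2top⟩ := hmem
  -- the floor extended to the left by a constant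
  set T : ℝ → ℝ := fun t => if t ≤ B.l then B.bot B.l + 0 * (t - B.l) else B.bot t with hT
  have hTlip : ∀ x y, |T x - T y| ≤ α * |x - y| :=
    lip_extend_left (lip_mono (lip_iff.mp B.bot_lip) hKα) B.l 0 (by simp)
  have hTge : ∀ t, B.l ≤ t → T t = B.bot t := by
    intro t ht
    simp only [hT]
    split_ifs with h
    · rw [le_antisymm h ht]; ring
    · rfl
  have hTle : ∀ t, t ≤ B.l → T t = B.bot B.l := by
    intro t ht; simp only [hT, if_pos ht]; ring
  -- `q.2 < bot` on `[q.1, xc] ∩ (-∞, l]`-side bookkeeping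
  have hbotl : q.1 ≤ B.l → B.l < xc → q.2 < B.bot B.l := fun hql hlt =>
    hbelow B.l (max_le hql le_rfl) hlt
  set g : ℝ → ℝ := fun t => if t ≤ xc then min q.2 (T t - ε) else B.bot t - ε with hg
  have hg₁lip : ∀ x y, |min q.2 (T x - ε) - min q.2 (T y - ε)| ≤ α * |x - y| :=
    lip_min_const (lip_add_const hTlip (-ε)) q.2
  have hg₂lip : ∀ x y, |(B.bot x - ε) - (B.bot y - ε)| ≤ α * |x - y| :=
    lip_add_const (lip_mono (lip_iff.mp B.bot_lip) hKα) (-ε)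
  have hTxc : T xc = B.bot xc := hTge xc hlxc
  have hgxc : min q.2 (T xc - ε) = B.bot xc - ε := by
    rw [hTxc]; exact min_eq_right (by linarith)
  have hglip : ∀ x y, |g x - g y| ≤ α * |x - y| := lip_glue hg₁lip hg₂lip hgxc
  have hgr : g B.r = f' B.r := by
    simp only [hg]
    split_ifs with h
    · have : xc = B.r := le_antisymm hxcr h
      rw [← this, hgxc, this, hf'r]
    · rw [hf'r]
  set F : ℝ → ℝ := fun t => if t ≤ B.r then g t else f' t with hF
  have hFlip : ∀ x y, |F x - F y| ≤ α * |x - y| := lip_glue hglip hf' hgr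
  have hhug : ∀ x, B.l ≤ x → x ≤ B.r → ∀ B' ∈ 𝔅, (x, B.bot x - ε) ∉ B'.toSet := by
    intro x hxl hxr B' hB'
    have hfloor : (x, B.bot x) ∈ B.toSet := Blob.bot_mem hxl hxr
    by_cases hB'B : B' = B
    · rw [hB'B]
      rintro ⟨-, -, h3, -⟩
      simp only at h3; linarith
    · intro hmem'
      have := hsep B' hB' hB'B _ hfloor _ hmem'
      have hd : dist (x, B.bot x) (x, B.bot x - ε) = ε := by
        rw [Prod.dist_eq, dist_self, Real.dist_eq,
          show B.bot x - (B.bot x - ε) = ε by ring, abs_of_pos hε, max_eq_right hε.le]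
      linarith
  -- the extended floor minus `ε` stays above `q.2` left of `l`
  have hleft : ∀ x, q.1 ≤ x → x ≤ B.l → x ≤ xc → q.2 ≤ T x - ε := by
    intro x hx hxl hxxc
    rw [hTle x hxl]
    have hql : q.1 ≤ B.l := hx.trans hxl
    rcases hql.lt_or_eq with hlt | heq
    · have := hε₃ hlt; linarith
    · have h1 := hε₄ heq.ge
      rw [heq] at h1
      linarith
  refine ⟨F, hFlip, ?_, ?_⟩
  · have hq1r : q.1 ≤ B.r := hqxc.le.trans hxcr
    simp only [hF, if_pos hq1r, hg, if_pos hqxc.le]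
    apply min_eq_left
    by_cases hql : q.1 ≤ B.l
    · exact hleft q.1 le_rfl hql hqxc.le
    · push Not at hql
      rw [hTge q.1 hql.le]
      have := hε₄ hql.le
      linarith
  · intro x hx B' hB'
    simp only [hF]
    split_ifs with hxr
    · simp only [hg]
      split_ifs with hxxc
      · by_cases hflat : q.2 ≤ T x - ε
        · rw [min_eq_left hflat]
          have hlt : x < xc := by
            rcases hxxc.lt_or_eq with h | h
            · exact h
            · exfalso; rw [h, hTxc] at hflat; linarith
          exact hfirst x hx hlt B' hB'
        · push Not at hflat
          rw [min_eq_right hflat.le]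
          have hxl : B.l < x := by
            by_contra hle
            push Not at hle
            exact absurd (hleft x hx hle hxxc) (not_le.mpr hflat)
          rw [hTge x hxl.le]
          exact hhug x hxl.le (hxxc.trans hxcr) B' hB'
      · push Not at hxxc
        exact hhug x (hlxc.trans hxxc.le) hxr B' hB'
    · push Not at hxr
      by_cases hB'B : B' = B
      · rw [hB'B]
        rintro ⟨-, h2, -, -⟩
        simp only at h2; linarith
      · exact hf'safe x hxr.le B' hB' hB'B

/-! ### The greedy path to the right, and the bi-infinite path -/

/-- **Greedy flat path to the right** (Prop. 4.9 (4)): past finitely many pairwise disjoint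
blobs with `K`-Lipschitz boundaries, from any point outside them there is an `α`-Lipschitz
function (`α ≥ K`, `α > 0`) through the point whose graph to the right misses every blob.
[cite: Hochman2025, Prop 4.9 (4)] -/
theorem exists_path_Ici {α : ℝ≥0} (hKα : K ≤ α) (hα : 0 < (α : ℝ)) (n : ℕ) :
    ∀ 𝔅 : Finset (Blob K), 𝔅.card = n →
      (∀ B ∈ 𝔅, ∀ B' ∈ 𝔅, B ≠ B' → Disjoint B.toSet B'.toSet) →
      ∀ q : ℝ × ℝ, (∀ B ∈ 𝔅, q ∉ B.toSet) →
        ∃ f : ℝ → ℝ, (∀ x y, |f x - f y| ≤ α * |x - y|) ∧ f q.1 = q.2 ∧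
          ∀ x, q.1 ≤ x → ∀ B ∈ 𝔅, (x, f x) ∉ B.toSet := by
  induction n using Nat.strong_induction_on with
  | _ n ih =>
    intro 𝔅 hcard hdisj q hq
    rcases first_contact 𝔅 q hq with hfree | ⟨xc, hqxc, ⟨B, hB, hmem⟩, hfirst⟩
    · refine ⟨fun _ => q.2, fun x y => ?_, rfl, fun x hx B hB => hfree x hx B hB⟩
      rw [sub_self, abs_zero]; positivity
    · -- distances to the other blobs, and the continuation by induction
      obtain ⟨δ₀, hδ₀, hsep⟩ := exists_pos_le_dist_others hdisj hB
      have hcard' : (𝔅.erase B).card < n := by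
        rw [Finset.card_erase_of_mem hB, hcard]
        have : 0 < n := by rw [← hcard]; exact Finset.card_pos.mpr ⟨B, hB⟩
        omega
      have hdisj' : ∀ B₁ ∈ 𝔅.erase B, ∀ B₂ ∈ 𝔅.erase B, B₁ ≠ B₂ → Disjoint B₁.toSet B₂.toSet :=
        fun B₁ h₁ B₂ h₂ hne => hdisj B₁ (Finset.mem_of_mem_erase h₁) B₂ (Finset.mem_of_mem_erase h₂) hne
      have hmem' := hmem
      obtain ⟨hlxc, hxcr, hbotq, hq2top⟩ := hmem'
      rcases contact_side B q hqxc hmem (fun x hx hlt => hfirst x hx hlt B hB) with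
        habove | ⟨hlxc', hbelow⟩
      · -- pass over `B`
        set c : ℝ := if q.1 < B.l then α * (B.l - q.1) else (q.2 - B.top q.1) / 2 with hc
        have hcpos : 0 < c := by
          simp only [hc]
          split_ifs with h
          · exact mul_pos hα (by linarith)
          · push Not at h
            have := habove q.1 (max_le le_rfl h) hqxc
            linarith
        set ε := min (δ₀ / 2) (min (α * δ₀ / 2) c) with hεdef
        have hε : 0 < ε := lt_min (by linarith) (lt_min (by positivity) hcpos)
        have hε₁ : ε ≤ δ₀ / 2 := min_le_left _ _
        have hε₂ : ε ≤ α * δ₀ / 2 := (min_le_right _ _).trans (min_le_left _ _)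
        have hεc : ε ≤ c := (min_le_right _ _).trans (min_le_right _ _)
        have hε₃ : q.1 < B.l → ε ≤ α * (B.l - q.1) := by
          intro h; have := hεc; simp only [hc, if_pos h] at this; exact this
        have hε₄ : B.l ≤ q.1 → ε < q.2 - B.top q.1 := by
          intro h
          have := hεc
          simp only [hc, if_neg (not_lt.mpr h)] at this
          have h2 := habove q.1 (max_le le_rfl h) hqxc
          linarith
        -- the continuation from `(r, top r + ε)`
        set q' : ℝ × ℝ := (B.r, B.top B.r + ε) with hq'
        have hq'out : ∀ B' ∈ 𝔅.erase B, q' ∉ B'.toSet := by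
          intro B' hB' hmem'
          obtain ⟨hne, hB'𝔅⟩ := Finset.mem_erase.mp hB'
          have hroof : (B.r, B.top B.r) ∈ B.toSet := Blob.top_mem B.hlr le_rfl
          have := hsep B' hB'𝔅 hne _ hroof _ hmem'
          have hd : dist (B.r, B.top B.r) q' = ε := by
            rw [hq', Prod.dist_eq, dist_self, Real.dist_eq,
              show B.top B.r - (B.top B.r + ε) = -ε by ring, abs_neg, abs_of_pos hε,
              max_eq_right hε.le]
          linarith
        obtain ⟨f', hf'lip, hf'r, hf'safe⟩ := ih _ hcard' (𝔅.erase B) rfl hdisj' q' hq'out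
        refine over_segment hKα hα q hqxc hmem hfirst habove hsep hε hε₁ hε₂ hε₃ hε₄ f' hf'lip
          hf'r fun x hx B' hB' hne => hf'safe x hx B' (Finset.mem_erase.mpr ⟨hne, hB'⟩)
      · -- pass under `B`
        set c : ℝ := if q.1 < B.l then (B.bot B.l - q.2) / 2 else (B.bot q.1 - q.2) / 2 with hc
        have hcpos : 0 < c := by
          simp only [hc]
          split_ifs with h
          · have := hbelow B.l (max_le h.le le_rfl) hlxc'
            linarith
          · push Not at h
            have := hbelow q.1 (max_le le_rfl h) hqxc
            linarith
        set ε := min (δ₀ / 2) c with hεdef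
        have hε : 0 < ε := lt_min (by linarith) hcpos
        have hε₁ : ε ≤ δ₀ / 2 := min_le_left _ _
        have hεc : ε ≤ c := min_le_right _ _
        have hε₃ : q.1 < B.l → ε < B.bot B.l - q.2 := by
          intro h
          have := hεc
          simp only [hc, if_pos h] at this
          have h2 := hbelow B.l (max_le h.le le_rfl) hlxc'
          linarith
        have hε₄ : B.l ≤ q.1 → ε < B.bot q.1 - q.2 := by
          intro h
          have := hεc
          simp only [hc, if_neg (not_lt.mpr h)] at this
          have h2 := hbelow q.1 (max_le le_rfl h) hqxc
          linarith
        set q' : ℝ × ℝ := (B.r, B.bot B.r - ε) with hq'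
        have hq'out : ∀ B' ∈ 𝔅.erase B, q' ∉ B'.toSet := by
          intro B' hB' hmem'
          obtain ⟨hne, hB'𝔅⟩ := Finset.mem_erase.mp hB'
          have hfloor : (B.r, B.bot B.r) ∈ B.toSet := Blob.bot_mem B.hlr le_rfl
          have := hsep B' hB'𝔅 hne _ hfloor _ hmem'
          have hd : dist (B.r, B.bot B.r) q' = ε := by
            rw [hq', Prod.dist_eq, dist_self, Real.dist_eq,
              show B.bot B.r - (B.bot B.r - ε) = ε by ring, abs_of_pos hε, max_eq_right hε.le]
          linarith
        obtain ⟨f', hf'lip, hf'r, hf'safe⟩ := ih _ hcard' (𝔅.erase B) rfl hdisj' q' hq'out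
        refine under_segment hKα q hqxc hmem hfirst hbelow hsep hε hε₁ hε₃ hε₄ f' hf'lip hf'r
          fun x hx B' hB' hne => hf'safe x hx B' (Finset.mem_erase.mpr ⟨hne, hB'⟩)


/-- **A bi-infinite flat path through a point outside the obstacles** (Prop. 4.9 (4): "there
exists a polygonal graph `γ` passing through `p`, disjoint from `H`, and with all line segments
in the path having slope at most `α₁`"): for finitely many pairwise disjoint blobs with
`K`-Lipschitz boundaries and `q` outside all of them, there is an `α`-Lipschitz `f : ℝ → ℝ`
(`α ≥ K`, `α > 0`) with `f q.1 = q.2` whose whole graph misses every blob. (Greedy paths to the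
right and, by the reflection `x ↦ -x`, to the left, glued at `q`.) [cite: Hochman2025, Prop 4.9 (4)] -/
theorem exists_path {α : ℝ≥0} (hKα : K ≤ α) (hα : 0 < (α : ℝ)) (𝔅 : Finset (Blob K))
    (hdisj : ∀ B ∈ 𝔅, ∀ B' ∈ 𝔅, B ≠ B' → Disjoint B.toSet B'.toSet)
    (q : ℝ × ℝ) (hq : ∀ B ∈ 𝔅, q ∉ B.toSet) :
    ∃ f : ℝ → ℝ, LipschitzWith α f ∧ f q.1 = q.2 ∧ ∀ x, ∀ B ∈ 𝔅, (x, f x) ∉ B.toSet := by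
  obtain ⟨fR, hfRlip, hfRq, hfRsafe⟩ := exists_path_Ici hKα hα _ 𝔅 rfl hdisj q hq
  -- the reflected family
  set 𝔅r := 𝔅.image Blob.reflect with h𝔅r
  have hdisjr : ∀ B ∈ 𝔅r, ∀ B' ∈ 𝔅r, B ≠ B' → Disjoint B.toSet B'.toSet := by
    intro Br hBr Br' hBr' hne
    obtain ⟨B, hB, rfl⟩ := Finset.mem_image.mp hBr
    obtain ⟨B', hB', rfl⟩ := Finset.mem_image.mp hBr'
    have hne' : B ≠ B' := fun h => hne (by rw [h])
    have hd := hdisj B hB B' hB' hne'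
    rw [Set.disjoint_left] at hd ⊢
    intro p hp hp'
    rw [Blob.mem_reflect] at hp hp'
    exact hd hp hp'
  set qr : ℝ × ℝ := (-q.1, q.2) with hqr
  have hqr_out : ∀ B ∈ 𝔅r, qr ∉ B.toSet := by
    intro Br hBr hmem
    obtain ⟨B, hB, rfl⟩ := Finset.mem_image.mp hBr
    rw [Blob.mem_reflect] at hmem
    simp only [hqr, neg_neg] at hmem
    exact hq B hB hmem
  obtain ⟨g, hglip, hgq, hgsafe⟩ := exists_path_Ici hKα hα _ 𝔅r rfl hdisjr qr hqr_out
  set fL : ℝ → ℝ := fun x => g (-x) with hfL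
  have hfLlip : ∀ x y, |fL x - fL y| ≤ α * |x - y| := by
    intro x y
    have := hglip (-x) (-y)
    rwa [show -x - -y = -(x - y) by ring, abs_neg] at this
  have hfLq : fL q.1 = q.2 := by simp only [hfL]; exact hgq
  have hjoin : fL q.1 = fR q.1 := by rw [hfLq, hfRq]
  set f : ℝ → ℝ := fun x => if x ≤ q.1 then fL x else fR x with hf
  refine ⟨f, lip_iff.mpr (lip_glue hfLlip hfRlip hjoin), ?_, ?_⟩
  · simp only [hf, if_pos le_rfl]; exact hfLq
  · intro x B hB
    simp only [hf]
    split_ifs with hx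
    · intro hmem
      have hBr : B.reflect ∈ 𝔅r := Finset.mem_image_of_mem _ hB
      have hx' : qr.1 ≤ -x := by simp only [hqr]; linarith
      apply hgsafe (-x) hx' B.reflect hBr
      rw [Blob.mem_reflect]
      simpa [hfL] using hmem
    · push Not at hx
      exact hfRsafe x hx.le B hB


/-! ### Merging finitely many compact intervals into disjoint classes

To present an `x`-monotone region with a possibly disconnected support as a family of blobs one
needs the connected components of a finite union of compact intervals `[a i, b i]`, `i ∈ I`.
We index them by the classes of the equivalence "joined by a chain of pairwise intersecting
intervals": the class of `i` has hull `[A i, B i]` (`A` the least left end, `B` the largest right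
end in the class); the hull is covered by the intervals of the class, hulls of non-equivalent
indices are disjoint, and no interval straddles an end of a hull. -/

section IntervalClasses

variable {ι : Type*} (I : Finset ι) (a b : ι → ℝ)

/-- Two compact intervals `[a i, b i]`, `[a j, b j]` intersect. [folklore] -/
def Meets (i j : ι) : Prop := a i ≤ b j ∧ a j ≤ b i

/-- `i` and `j` are joined by a chain of members of `I` with consecutively intersecting
intervals. [folklore] -/
def Linked (i j : ι) : Prop :=
  Relation.ReflTransGen (fun i j => i ∈ I ∧ j ∈ I ∧ Meets a b i j) i j

variable {I a b}

/-- `Meets` is symmetric. [folklore] -/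
theorem Meets.symm {i j : ι} (h : Meets a b i j) : Meets a b j i := ⟨h.2, h.1⟩

/-- `Linked` is symmetric. [folklore] -/
theorem Linked.symm {i j : ι} (h : Linked I a b i j) : Linked I a b j i := by
  induction h with
  | refl => exact Relation.ReflTransGen.refl
  | tail _ hbc ih => exact Relation.ReflTransGen.head ⟨hbc.2.1, hbc.1, hbc.2.2.symm⟩ ih

/-- `Linked` is transitive. [folklore] -/
theorem Linked.trans {i j k : ι} (h₁ : Linked I a b i j) (h₂ : Linked I a b j k) : Linked I a b i k :=
  Relation.ReflTransGen.trans h₁ h₂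

/-- The far end of a link lies in `I` (or the link is trivial). [folklore] -/
theorem Linked.mem_or_eq {i j : ι} (h : Linked I a b i j) : j ∈ I ∨ j = i := by
  induction h with
  | refl => exact Or.inr rfl
  | tail _ hbc _ => exact Or.inl hbc.2.1

/-- The class of `i`: the members of `I` linked to it. [folklore] -/
def cls (I : Finset ι) (a b : ι → ℝ) (i : ι) : Finset ι := I.filter fun j => Linked I a b i j

/-- Membership in a class. [folklore] -/
theorem mem_cls {i j : ι} : j ∈ cls I a b i ↔ j ∈ I ∧ Linked I a b i j := Finset.mem_filter

/-- A member of `I` belongs to its own class. [folklore] -/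
theorem mem_cls_self {i : ι} (hi : i ∈ I) : i ∈ cls I a b i :=
  mem_cls.mpr ⟨hi, Relation.ReflTransGen.refl⟩

/-- Linked indices have the same class. [folklore] -/
theorem cls_eq_of_linked {i i' : ι} (h : Linked I a b i i') : cls I a b i = cls I a b i' := by
  ext j
  simp only [mem_cls]
  exact ⟨fun ⟨hj, hl⟩ => ⟨hj, h.symm.trans hl⟩, fun ⟨hj, hl⟩ => ⟨hj, h.trans hl⟩⟩

/-- The left end of the hull of the class of `i` (for `i ∈ I`; junk otherwise). [folklore] -/
def hullLeft (I : Finset ι) (a b : ι → ℝ) (i : ι) : ℝ :=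
  if h : (cls I a b i).Nonempty then (cls I a b i).inf' h a else a i

/-- The right end of the hull of the class of `i`. [folklore] -/
def hullRight (I : Finset ι) (a b : ι → ℝ) (i : ι) : ℝ :=
  if h : (cls I a b i).Nonempty then (cls I a b i).sup' h b else b i

/-- `hullLeft`, unfolded. [folklore] -/
theorem hullLeft_eq {i : ι} (hi : i ∈ I) :
    hullLeft I a b i = (cls I a b i).inf' ⟨i, mem_cls_self hi⟩ a := by
  unfold hullLeft
  split_ifs with h
  · rfl
  · exact absurd ⟨i, mem_cls_self hi⟩ h

/-- `hullRight`, unfolded. [folklore] -/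
theorem hullRight_eq {i : ι} (hi : i ∈ I) :
    hullRight I a b i = (cls I a b i).sup' ⟨i, mem_cls_self hi⟩ b := by
  unfold hullRight
  split_ifs with h
  · rfl
  · exact absurd ⟨i, mem_cls_self hi⟩ h

/-- Linked indices have the same hull. [folklore] -/
theorem hull_eq_of_linked {i i' : ι} (hi : i ∈ I) (hi' : i' ∈ I) (h : Linked I a b i i') :
    hullLeft I a b i = hullLeft I a b i' ∧ hullRight I a b i = hullRight I a b i' := by
  have hc := cls_eq_of_linked h
  rw [hullLeft_eq hi, hullLeft_eq hi', hullRight_eq hi, hullRight_eq hi']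
  constructor
  · exact Finset.inf'_congr _ hc (fun _ _ => rfl)
  · exact Finset.sup'_congr _ hc (fun _ _ => rfl)

/-- The hull contains the intervals of the class. [folklore] -/
theorem hullLeft_le {i j : ι} (hi : i ∈ I) (hj : j ∈ cls I a b i) : hullLeft I a b i ≤ a j := by
  rw [hullLeft_eq hi]; exact Finset.inf'_le _ hj

/-- The hull contains the intervals of the class. [folklore] -/
theorem le_hullRight {i j : ι} (hi : i ∈ I) (hj : j ∈ cls I a b i) : b j ≤ hullRight I a b i := by
  rw [hullRight_eq hi]; exact Finset.le_sup' _ hj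

/-- The left end of the hull is the left end of some interval of the class. [folklore] -/
theorem exists_hullLeft_eq {i : ι} (hi : i ∈ I) : ∃ j ∈ cls I a b i, hullLeft I a b i = a j := by
  rw [hullLeft_eq hi]
  obtain ⟨j, hj, h⟩ := Finset.exists_mem_eq_inf' (⟨i, mem_cls_self hi⟩ : (cls I a b i).Nonempty) a
  exact ⟨j, hj, h⟩

/-- The right end of the hull is the right end of some interval of the class. [folklore] -/
theorem exists_hullRight_eq {i : ι} (hi : i ∈ I) : ∃ j ∈ cls I a b i, hullRight I a b i = b j := by
  rw [hullRight_eq hi]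
  obtain ⟨j, hj, h⟩ := Finset.exists_mem_eq_sup' (⟨i, mem_cls_self hi⟩ : (cls I a b i).Nonempty) b
  exact ⟨j, hj, h⟩

/-- A segment lies in the union of the two segments through any intermediate stop. [folklore] -/
theorem mem_segments_of_mem_segment (u v w x : ℝ) (h : min u w ≤ x ∧ x ≤ max u w) :
    (min u v ≤ x ∧ x ≤ max u v) ∨ (min v w ≤ x ∧ x ≤ max v w) := by
  obtain ⟨h1, h2⟩ := h
  rw [min_le_iff] at h1
  rw [le_max_iff] at h2
  by_cases hxv : x ≤ v
  · by_cases hux : u ≤ x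
    · exact Or.inl ⟨min_le_of_left_le hux, le_max_of_le_right hxv⟩
    · push Not at hux
      have hw : w ≤ x := by rcases h1 with h | h; exact absurd h (not_le.mpr hux); exact h
      exact Or.inr ⟨min_le_of_right_le hw, le_max_of_le_left hxv⟩
  · push Not at hxv
    by_cases hxu : x ≤ u
    · exact Or.inl ⟨min_le_of_right_le hxv.le, le_max_of_le_left hxu⟩
    · push Not at hxu
      have hw : x ≤ w := by rcases h2 with h | h; exact absurd h (not_le.mpr hxu); exact h
      exact Or.inr ⟨min_le_of_left_le hxv.le, le_max_of_le_right hw⟩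

/-- **A chain of consecutively intersecting intervals covers the segment between its ends.**
[folklore] -/
theorem chain_cover (hab : ∀ j ∈ I, a j ≤ b j) {j k : ι} (hjI : j ∈ I) (h : Linked I a b j k)
    {u w x : ℝ} (hu : a j ≤ u ∧ u ≤ b j) (hw : a k ≤ w ∧ w ≤ b k)
    (hx : min u w ≤ x ∧ x ≤ max u w) :
    ∃ m, Linked I a b j m ∧ m ∈ I ∧ a m ≤ x ∧ x ≤ b m := by
  induction h generalizing w x with
  | refl =>
    refine ⟨j, Relation.ReflTransGen.refl, hjI, ?_, ?_⟩
    · have := hx.1; rw [min_le_iff] at this; rcases this with h | h <;> linarith [hu.1, hw.1]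
    · have := hx.2; rw [le_max_iff] at this; rcases this with h | h <;> linarith [hu.2, hw.2]
  | tail hjk' hk'k ih =>
    rename_i k' k
    obtain ⟨hk'I, hkI, hmeets⟩ := hk'k
    -- a common point of the last two intervals
    set v := max (a k') (a k) with hv
    have hvk' : a k' ≤ v ∧ v ≤ b k' := ⟨le_max_left _ _, max_le (hab k' hk'I) hmeets.2⟩
    have hvk : a k ≤ v ∧ v ≤ b k := ⟨le_max_right _ _, max_le hmeets.1 (hab k hkI)⟩
    rcases mem_segments_of_mem_segment u v w x hx with hx' | hx'
    · exact ih hvk' hx'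
    · refine ⟨k, hjk'.tail ⟨hk'I, hkI, hmeets⟩, hkI, ?_, ?_⟩
      · have := hx'.1; rw [min_le_iff] at this; rcases this with h | h <;> linarith [hvk.1, hw.1]
      · have := hx'.2; rw [le_max_iff] at this; rcases this with h | h <;> linarith [hvk.2, hw.2]

/-- **The hull of a class is covered by the intervals of the class.** [folklore] -/
theorem exists_mem_of_mem_hull (hab : ∀ j ∈ I, a j ≤ b j) {i : ι} (hi : i ∈ I) {x : ℝ}
    (hx : hullLeft I a b i ≤ x ∧ x ≤ hullRight I a b i) :
    ∃ j ∈ cls I a b i, a j ≤ x ∧ x ≤ b j := by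
  obtain ⟨j₁, hj₁, hA⟩ := exists_hullLeft_eq (a := a) (b := b) hi
  obtain ⟨j₂, hj₂, hB⟩ := exists_hullRight_eq (a := a) (b := b) hi
  obtain ⟨hj₁I, hl₁⟩ := mem_cls.mp hj₁
  obtain ⟨hj₂I, hl₂⟩ := mem_cls.mp hj₂
  have hlink : Linked I a b j₁ j₂ := hl₁.symm.trans hl₂
  have hu : a j₁ ≤ a j₁ ∧ a j₁ ≤ b j₁ := ⟨le_rfl, hab j₁ hj₁I⟩
  have hw : a j₂ ≤ b j₂ ∧ b j₂ ≤ b j₂ := ⟨hab j₂ hj₂I, le_rfl⟩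
  have hx' : min (a j₁) (b j₂) ≤ x ∧ x ≤ max (a j₁) (b j₂) := by
    rw [← hA, ← hB]
    exact ⟨min_le_of_left_le hx.1, le_max_of_le_right hx.2⟩
  obtain ⟨m, hlm, hmI, hm⟩ := chain_cover hab hj₁I hlink hu hw hx'
  exact ⟨m, mem_cls.mpr ⟨hmI, hl₁.trans hlm⟩, hm⟩

/-- **Hulls of non-linked indices are disjoint.** [folklore] -/
theorem linked_or_disjoint (hab : ∀ j ∈ I, a j ≤ b j) {i i' : ι} (hi : i ∈ I) (hi' : i' ∈ I) :
    Linked I a b i i' ∨ hullRight I a b i < hullLeft I a b i' ∨ hullRight I a b i' < hullLeft I a b i := by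
  by_contra h
  push Not at h
  obtain ⟨hnl, h1, h2⟩ := h
  -- a common point of the two hulls
  set x := max (hullLeft I a b i) (hullLeft I a b i') with hx
  have hxi : hullLeft I a b i ≤ x ∧ x ≤ hullRight I a b i := ⟨le_max_left _ _, max_le (by
    obtain ⟨j, hj, h⟩ := exists_hullLeft_eq (a := a) (b := b) hi
    rw [h]; exact (hab j (mem_cls.mp hj).1).trans (le_hullRight hi hj)) h1⟩
  have hxi' : hullLeft I a b i' ≤ x ∧ x ≤ hullRight I a b i' := ⟨le_max_right _ _, max_le h2 (by
    obtain ⟨j, hj, h⟩ := exists_hullLeft_eq (a := a) (b := b) hi'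
    rw [h]; exact (hab j (mem_cls.mp hj).1).trans (le_hullRight hi' hj))⟩
  obtain ⟨j, hj, hjx⟩ := exists_mem_of_mem_hull hab hi hxi
  obtain ⟨j', hj', hj'x⟩ := exists_mem_of_mem_hull hab hi' hxi'
  obtain ⟨hjI, hlj⟩ := mem_cls.mp hj
  obtain ⟨hj'I, hlj'⟩ := mem_cls.mp hj'
  have hmeets : Meets a b j j' := ⟨hjx.1.trans hj'x.2, hj'x.1.trans hjx.2⟩
  exact hnl ((hlj.trans (Relation.ReflTransGen.single ⟨hjI, hj'I, hmeets⟩)).trans hlj'.symm)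

/-- **No interval straddles the left end of a hull**: an interval of `I` starting strictly
before `hullLeft` also ends strictly before it. [folklore] -/
theorem lt_hullLeft_of_lt (hab : ∀ j ∈ I, a j ≤ b j) {i j : ι} (hi : i ∈ I) (hj : j ∈ I)
    (h : a j < hullLeft I a b i) : b j < hullLeft I a b i := by
  by_contra hle
  push Not at hle
  obtain ⟨k, hk, hA⟩ := exists_hullLeft_eq (a := a) (b := b) hi
  obtain ⟨hkI, hlk⟩ := mem_cls.mp hk
  rw [hA] at h hle
  have hmeets : Meets a b k j := ⟨hle, h.le.trans (hab k hkI)⟩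
  have hjcls : j ∈ cls I a b i := mem_cls.mpr ⟨hj, hlk.tail ⟨hkI, hj, hmeets⟩⟩
  have := hullLeft_le hi hjcls
  rw [hA] at this
  linarith

/-- **No interval straddles the right end of a hull.** [folklore] -/
theorem hullRight_lt_of_lt (hab : ∀ j ∈ I, a j ≤ b j) {i j : ι} (hi : i ∈ I) (hj : j ∈ I)
    (h : hullRight I a b i < b j) : hullRight I a b i < a j := by
  by_contra hle
  push Not at hle
  obtain ⟨k, hk, hB⟩ := exists_hullRight_eq (a := a) (b := b) hi
  obtain ⟨hkI, hlk⟩ := mem_cls.mp hk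
  rw [hB] at h hle
  have hmeets : Meets a b k j := ⟨(hab k hkI).trans h.le, hle⟩
  have hjcls : j ∈ cls I a b i := mem_cls.mpr ⟨hj, hlk.tail ⟨hkI, hj, hmeets⟩⟩
  have := le_hullRight hi hjcls
  rw [hB] at this
  linarith

end IntervalClasses

end SafePaths

end Hochman2025

end Literature.Dynamics.SymbolicDynamics
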